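import Summits.NavierStokesRegularity.NavierStokesRegularity.Theorems.CoreLogGasBlowupIsLocallyDrivenCoresCollapse
import Summits.NavierStokesRegularity.NavierStokesRegularity.Theorems.CoreLogGasBlowupIsLocallyDrivenFarFieldReduction

/-!
# Crux `CoreLogGas.BlowupIsLocallyDriven` (stmt-NavierStokesRegularity-11291), line `registered`:
# the crux, shell locality and shell locality in the collapsing-core regime are EQUIVALENT

`--supports stmt-NavierStokesRegularity-11291` (lead `prover-line-stmt-NavierStokesRegularity-11291-c3-0`, 2026-08-17).

Line `registered` cuts the exterior `{|y − x| ≥ Mρ}` of the truncation ball of the crux B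
(`Theses.CoreLogGas.BlowupIsLocallyDriven`) at a fixed macroscopic radius `R` into a FAR FIELD `{|y − x| ≥ R}` and a
SHELL `{Mρ ≤ |y − x| < R}`, and discharges the far field (`farFieldStrain`, p152530), the enstrophy control
(`stub_enstrophyControl`, p148607) and the regime reduction (`coresCollapse` / `shellLocality_of_collapseCase`, p153086):
B ⟸ shell locality ⟸ shell locality for solutions with collapsing cores (= the one open registered stub
`stub_shellLocalityCollapse`).

This file proves the CONVERSE arrows, so that all three statements are equivalent:

* `shellLocality_of_blowupIsLocallyDriven` — **B ⇒ shell locality** with `R = 1` and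
  `g₁ := |g| + C (√(3⁵) ‖u 0‖₂ + √(3³) ‖∇u(t)‖₂)`: at an admissible triple with `Mρ ≤ 1` the shell gradient
  `∇BS[1_{B(x,1)}ω](x) − ∇BS[1_{B(x,Mρ)}ω](x)` is `(∇BS[1_{B(x,1)}ω](x) − ∇u(x)) + (∇u(x) − ∇BS[1_{B(x,Mρ)}ω](x))`; the
  first bracket is the far field at radius `1` (`farFieldStrain` + energy bound + `stub_enstrophyControl`), the second
  is B's defect.
* `blowupIsLocallyDriven_iff_shellLocality`, `blowupIsLocallyDriven_iff_shellLocalityCollapse`,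
  `shellLocality_iff_shellLocalityCollapse` — the equivalences (the remaining arrows are the landed
  `blowupIsLocallyDriven_of_shellLocality` and `shellLocality_of_collapseCase`).

Consequence for the line (recorded in `Cruxes/BlowupIsLocallyDriven/Lines/registered.dead.md`): the far-field / regime
cut has isolated the difficulty completely — the open stub is the crux itself up to an integrable far-field term — so
no reshape inside this line can lower it; together with the negative lemma
`Negative.BlowupIsLocallyDriven_false_of_RigidFarStrainBlowup` (p154961) this is the formal content of the outcome
`line-dead: registered`.

References: T. Tao, arXiv:1108.1165 §10 (local Biot–Savart law); J. T. Beale, T. Kato, A. Majda, Comm. Math. Phys. 94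
(1984), Thm. 1.
-/

noncomputable section

open Set MeasureTheory Filter Topology Metric
open scoped ContDiff

-- justification: the stub namespace is fixed by the crux protocol (sibling stub files use the same one).
set_option linter.dupNamespace false

namespace Summit.NavierStokesRegularity.NavierStokesRegularity.Theorems.BlowupIsLocallyDriven.Registered

open Literature.Analysis.FluidPDE

/-! ### Elementary lemma -/

/-- From `|⟪(U − A) e, e⟫| ≤ a` and `|⟪(U − C) e, e⟫| ≤ b` conclude `|⟪(A − C) e, e⟫| ≤ b + a`
(`A − C = (A − U) + (U − C)` and `|⟪(A − U) e, e⟫| = |⟪(U − A) e, e⟫|`). [folklore] -/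
theorem shellEquiv_abs_inner_sub_le_of_common
    (U A C : EuclideanSpace ℝ (Fin 3) →L[ℝ] EuclideanSpace ℝ (Fin 3)) (e : EuclideanSpace ℝ (Fin 3)) {a b : ℝ}
    (h1 : |inner ℝ ((U - A) e) e| ≤ a) (h2 : |inner ℝ ((U - C) e) e| ≤ b) :
    |inner ℝ ((A - C) e) e| ≤ b + a := by
  have hsymm : |inner ℝ ((A - U) e) e| = |inner ℝ ((U - A) e) e| := by
    have h : (A - U) e = -((U - A) e) := by
      change A e - U e = -(U e - A e); abel
    rw [h, inner_neg_left, abs_neg]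
  calc |inner ℝ ((A - C) e) e| ≤ |inner ℝ ((A - U) e) e| + |inner ℝ ((U - C) e) e| :=
      farField_abs_inner_sub_le_split A U C e
    _ ≤ a + b := add_le_add (hsymm ▸ h1) h2
    _ = b + a := add_comm _ _

/-! ### B implies shell locality -/

/-- **The crux B implies shell locality** (the converse of `blowupIsLocallyDriven_of_shellLocality`). If every maximal
finite-energy classical solution from Clay data satisfies B's locality clause with data `(M, t₀, g)`, then it satisfies
the shell-locality clause of line `registered` with `R = 1`, the same `M, t₀`, and
`g₁ := |g| + C (√((1/3)⁻⁵) ‖u 0‖₂ + √((1/3)⁻³) ‖∇u(t)‖₂)` (integrable by the energy bound and `stub_enstrophyControl`):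
the shell gradient is the far field at radius `1` (bounded by `farFieldStrain`) plus B's defect. [folklore] -/
theorem shellLocality_of_blowupIsLocallyDriven
    (hB : Summit.NavierStokesRegularity.NavierStokesRegularity.Theses.CoreLogGas.BlowupIsLocallyDriven) :
    ∀ (ν T : ℝ), 0 < ν → 0 < T →
    ∀ (u : ℝ → EuclideanSpace ℝ (Fin 3) → EuclideanSpace ℝ (Fin 3)) (p : ℝ → EuclideanSpace ℝ (Fin 3) → ℝ),
      Literature.Analysis.FluidPDE.IsMaximalSmoothSolution ν 0 u p T →
      Literature.Analysis.FluidPDE.IsLerayHopfOn T ν 0 (u 0) u →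
      Literature.Analysis.FluidPDE.HasRapidSpatialDecay (u 0) →
      ∃ (M t₀ R : ℝ) (g₁ : ℝ → ℝ), 1 ≤ M ∧ 0 ≤ t₀ ∧ t₀ < T ∧ 0 < R ∧
        MeasureTheory.IntegrableOn g₁ (Set.Ico t₀ T) ∧
        ∀ t ∈ Set.Ico t₀ T, ∀ (x : EuclideanSpace ℝ (Fin 3)) (ρ : ℝ), 0 < ρ → M * ρ ≤ R →
          (⨆ z, ‖Literature.Analysis.FluidPDE.curl (u t) z‖) ≤ 2 * ‖Literature.Analysis.FluidPDE.curl (u t) x‖ →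
          Metric.ball x ρ ⊆ {y | (⨆ z, ‖Literature.Analysis.FluidPDE.curl (u t) z‖) ≤ 4 * ‖Literature.Analysis.FluidPDE.curl (u t) y‖} →
          (∀ (x' : EuclideanSpace ℝ (Fin 3)) (ρ' : ℝ),
            (⨆ z, ‖Literature.Analysis.FluidPDE.curl (u t) z‖) ≤ 2 * ‖Literature.Analysis.FluidPDE.curl (u t) x'‖ →
            Metric.ball x' ρ' ⊆ {y | (⨆ z, ‖Literature.Analysis.FluidPDE.curl (u t) z‖) ≤ 4 * ‖Literature.Analysis.FluidPDE.curl (u t) y‖} →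
            ρ' ≤ 2 * ρ) →
          ∀ e : EuclideanSpace ℝ (Fin 3), ‖e‖ = 1 →
            |inner ℝ ((fderiv ℝ (fun z : EuclideanSpace ℝ (Fin 3) => ∫ y, (4 * Real.pi * ‖z - y‖ ^ 3)⁻¹ • Literature.Analysis.FluidPDE.cross ((Metric.ball x R).indicator (Literature.Analysis.FluidPDE.curl (u t)) y) (z - y)) x
              - fderiv ℝ (fun z : EuclideanSpace ℝ (Fin 3) => ∫ y, (4 * Real.pi * ‖z - y‖ ^ 3)⁻¹ • Literature.Analysis.FluidPDE.cross ((Metric.ball x (M * ρ)).indicator (Literature.Analysis.FluidPDE.curl (u t)) y) (z - y)) x) e) e|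
              ≤ g₁ t := by
  intro ν T hν hT u p hmax hlh hdec
  obtain ⟨C, hC0, hC⟩ := farFieldStrain
  have hcl : Literature.Analysis.FluidPDE.IsClassicalNSSolutionOn (Set.Ico 0 T) ν 0 u p := hmax.1
  obtain ⟨hint, hsq⟩ := stub_enstrophyControl ν T hν hT u p hcl hlh hdec
  obtain ⟨M, t₀, g, hM, ht₀, ht₀T, hg, hH⟩ := hB ν T hν hT u p hmax hlh hdec
  -- the far-field majorant at radius `1` (opaque name)
  obtain ⟨Φ, hΦ⟩ : ∃ Φ : ℝ → ℝ, Φ = fun t => C * (Real.sqrt (((1 : ℝ) / 3)⁻¹ ^ 5) * Real.sqrt (∫ y, ‖u 0 y‖ ^ 2) +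
      Real.sqrt (((1 : ℝ) / 3)⁻¹ ^ 3) * Real.sqrt (∫ y, ‖fderiv ℝ (u t) y‖ ^ 2)) := ⟨_, rfl⟩
  refine ⟨M, t₀, 1, fun t => |g t| + Φ t, hM, ht₀, ht₀T, one_pos, ?_, ?_⟩
  · -- integrability of `g₁` on `[t₀, T)`
    have hsub : Set.Ico t₀ T ⊆ Set.Ico 0 T := Set.Ico_subset_Ico_left ht₀
    have hN : MeasureTheory.IntegrableOn (fun t => Real.sqrt (∫ y, ‖fderiv ℝ (u t) y‖ ^ 2)) (Set.Ico t₀ T)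
        MeasureTheory.volume := hsq.mono_set hsub
    have hΦi : MeasureTheory.IntegrableOn Φ (Set.Ico t₀ T) MeasureTheory.volume := by
      have h1 : MeasureTheory.IntegrableOn
          (fun _ : ℝ => Real.sqrt (((1 : ℝ) / 3)⁻¹ ^ 5) * Real.sqrt (∫ y, ‖u 0 y‖ ^ 2))
          (Set.Ico t₀ T) MeasureTheory.volume := integrableOn_const (by simp)
      rw [hΦ]
      exact ((h1.add (hN.integrable.const_mul _)).integrable.const_mul C)
    exact hg.integrable.abs.add hΦi
  · intro t ht x ρ hρ hMρ hpeak hball hmaxrad e he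
    -- classical facts at the time slice `t`
    have ht' : t ∈ Set.Ico 0 T := ⟨ht₀.trans ht.1, ht.2⟩
    have hCi : ContDiff ℝ ∞ (u t) := hcl.contDiff_velocity ht'
    have hdiv : Literature.Analysis.FluidPDE.VectorCalculus.IsDivFree (u t) := hcl.divFree t ht'
    have hL2 : MeasureTheory.MemLp (u t) 2 MeasureTheory.volume := hlh.memLp t ⟨ht'.1, ht'.2.le⟩
    have hgrad : MeasureTheory.Integrable (fun y => ‖fderiv ℝ (u t) y‖ ^ 2) MeasureTheory.volume := hint t ht'
    -- energy: `‖u t‖₂ ≤ ‖u 0‖₂`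
    have hen : Real.sqrt (∫ y, ‖u t y‖ ^ 2) ≤ Real.sqrt (∫ y, ‖u 0 y‖ ^ 2) :=
      Real.sqrt_le_sqrt (farField_integral_norm_sq_le_datum hlh hν.le ⟨ht'.1, ht'.2.le⟩)
    -- the far field at radius `1` is at most `Φ t`
    have hfar :
        |inner ℝ ((fderiv ℝ (u t) x - fderiv ℝ (fun z : EuclideanSpace ℝ (Fin 3) => ∫ y, (4 * Real.pi * ‖z - y‖ ^ 3)⁻¹ • Literature.Analysis.FluidPDE.cross ((Metric.ball x 1).indicator (Literature.Analysis.FluidPDE.curl (u t)) y) (z - y)) x) e) e|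
          ≤ Φ t := by
      refine (hC (u t) hCi hdiv hL2 hgrad 1 one_pos x e he).trans ?_
      rw [hΦ]
      have hb0 : 0 ≤ Real.sqrt (∫ y, ‖fderiv ℝ (u t) y‖ ^ 2) := Real.sqrt_nonneg _
      have hs5 : 0 ≤ Real.sqrt (((1 : ℝ) / 3)⁻¹ ^ 5) := Real.sqrt_nonneg _
      refine mul_le_mul_of_nonneg_left (add_le_add ?_ le_rfl) hC0
      exact mul_le_mul_of_nonneg_left hen hs5
    -- B's defect at the same admissible triple
    have hloc := (hH t ht x ρ hρ hpeak hball hmaxrad e he).trans (le_abs_self (g t))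
    -- split the shell gradient through `∇u(t,x)`
    exact shellEquiv_abs_inner_sub_le_of_common _ _ _ e hfar hloc

/-! ### The equivalences -/

/-- **B ⇔ shell locality.** The crux `CoreLogGas.BlowupIsLocallyDriven` is equivalent to the shell-locality statement of
line `registered` (its original stub `stub_intermediateZone`): `⇐` is `blowupIsLocallyDriven_of_shellLocality`
(far field `farFieldStrain` + energy + enstrophy), `⇒` is `shellLocality_of_blowupIsLocallyDriven`. [folklore] -/
theorem blowupIsLocallyDriven_iff_shellLocality :
    Summit.NavierStokesRegularity.NavierStokesRegularity.Theses.CoreLogGas.BlowupIsLocallyDriven ↔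
    (∀ (ν T : ℝ), 0 < ν → 0 < T →
    ∀ (u : ℝ → EuclideanSpace ℝ (Fin 3) → EuclideanSpace ℝ (Fin 3)) (p : ℝ → EuclideanSpace ℝ (Fin 3) → ℝ),
      Literature.Analysis.FluidPDE.IsMaximalSmoothSolution ν 0 u p T →
      Literature.Analysis.FluidPDE.IsLerayHopfOn T ν 0 (u 0) u →
      Literature.Analysis.FluidPDE.HasRapidSpatialDecay (u 0) →
      ∃ (M t₀ R : ℝ) (g₁ : ℝ → ℝ), 1 ≤ M ∧ 0 ≤ t₀ ∧ t₀ < T ∧ 0 < R ∧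
        MeasureTheory.IntegrableOn g₁ (Set.Ico t₀ T) ∧
        ∀ t ∈ Set.Ico t₀ T, ∀ (x : EuclideanSpace ℝ (Fin 3)) (ρ : ℝ), 0 < ρ → M * ρ ≤ R →
          (⨆ z, ‖Literature.Analysis.FluidPDE.curl (u t) z‖) ≤ 2 * ‖Literature.Analysis.FluidPDE.curl (u t) x‖ →
          Metric.ball x ρ ⊆ {y | (⨆ z, ‖Literature.Analysis.FluidPDE.curl (u t) z‖) ≤ 4 * ‖Literature.Analysis.FluidPDE.curl (u t) y‖} →
          (∀ (x' : EuclideanSpace ℝ (Fin 3)) (ρ' : ℝ),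
            (⨆ z, ‖Literature.Analysis.FluidPDE.curl (u t) z‖) ≤ 2 * ‖Literature.Analysis.FluidPDE.curl (u t) x'‖ →
            Metric.ball x' ρ' ⊆ {y | (⨆ z, ‖Literature.Analysis.FluidPDE.curl (u t) z‖) ≤ 4 * ‖Literature.Analysis.FluidPDE.curl (u t) y‖} →
            ρ' ≤ 2 * ρ) →
          ∀ e : EuclideanSpace ℝ (Fin 3), ‖e‖ = 1 →
            |inner ℝ ((fderiv ℝ (fun z : EuclideanSpace ℝ (Fin 3) => ∫ y, (4 * Real.pi * ‖z - y‖ ^ 3)⁻¹ • Literature.Analysis.FluidPDE.cross ((Metric.ball x R).indicator (Literature.Analysis.FluidPDE.curl (u t)) y) (z - y)) x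
              - fderiv ℝ (fun z : EuclideanSpace ℝ (Fin 3) => ∫ y, (4 * Real.pi * ‖z - y‖ ^ 3)⁻¹ • Literature.Analysis.FluidPDE.cross ((Metric.ball x (M * ρ)).indicator (Literature.Analysis.FluidPDE.curl (u t)) y) (z - y)) x) e) e|
              ≤ g₁ t) :=
  ⟨shellLocality_of_blowupIsLocallyDriven, blowupIsLocallyDriven_of_shellLocality⟩

/-- **Shell locality ⇔ shell locality in the collapsing-core regime.** The unrestricted shell-locality statement and
its restriction to maximal solutions whose canonical quarter-max cores collapse (the open registered stub
`stub_shellLocalityCollapse` of line `registered`, statement verbatim) are equivalent: `⇐` is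
`shellLocality_of_collapseCase` (every maximal solution has collapsing cores, `coresCollapse`), `⇒` drops the
hypothesis. [folklore] -/
theorem shellLocality_iff_shellLocalityCollapse :
    (∀ (ν T : ℝ), 0 < ν → 0 < T →
    ∀ (u : ℝ → EuclideanSpace ℝ (Fin 3) → EuclideanSpace ℝ (Fin 3)) (p : ℝ → EuclideanSpace ℝ (Fin 3) → ℝ),
      Literature.Analysis.FluidPDE.IsMaximalSmoothSolution ν 0 u p T →
      Literature.Analysis.FluidPDE.IsLerayHopfOn T ν 0 (u 0) u →
      Literature.Analysis.FluidPDE.HasRapidSpatialDecay (u 0) →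
      ∃ (M t₀ R : ℝ) (g₁ : ℝ → ℝ), 1 ≤ M ∧ 0 ≤ t₀ ∧ t₀ < T ∧ 0 < R ∧
        MeasureTheory.IntegrableOn g₁ (Set.Ico t₀ T) ∧
        ∀ t ∈ Set.Ico t₀ T, ∀ (x : EuclideanSpace ℝ (Fin 3)) (ρ : ℝ), 0 < ρ → M * ρ ≤ R →
          (⨆ z, ‖Literature.Analysis.FluidPDE.curl (u t) z‖) ≤ 2 * ‖Literature.Analysis.FluidPDE.curl (u t) x‖ →
          Metric.ball x ρ ⊆ {y | (⨆ z, ‖Literature.Analysis.FluidPDE.curl (u t) z‖) ≤ 4 * ‖Literature.Analysis.FluidPDE.curl (u t) y‖} →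
          (∀ (x' : EuclideanSpace ℝ (Fin 3)) (ρ' : ℝ),
            (⨆ z, ‖Literature.Analysis.FluidPDE.curl (u t) z‖) ≤ 2 * ‖Literature.Analysis.FluidPDE.curl (u t) x'‖ →
            Metric.ball x' ρ' ⊆ {y | (⨆ z, ‖Literature.Analysis.FluidPDE.curl (u t) z‖) ≤ 4 * ‖Literature.Analysis.FluidPDE.curl (u t) y‖} →
            ρ' ≤ 2 * ρ) →
          ∀ e : EuclideanSpace ℝ (Fin 3), ‖e‖ = 1 →
            |inner ℝ ((fderiv ℝ (fun z : EuclideanSpace ℝ (Fin 3) => ∫ y, (4 * Real.pi * ‖z - y‖ ^ 3)⁻¹ • Literature.Analysis.FluidPDE.cross ((Metric.ball x R).indicator (Literature.Analysis.FluidPDE.curl (u t)) y) (z - y)) x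
              - fderiv ℝ (fun z : EuclideanSpace ℝ (Fin 3) => ∫ y, (4 * Real.pi * ‖z - y‖ ^ 3)⁻¹ • Literature.Analysis.FluidPDE.cross ((Metric.ball x (M * ρ)).indicator (Literature.Analysis.FluidPDE.curl (u t)) y) (z - y)) x) e) e|
              ≤ g₁ t) ↔
    (∀ (ν T : ℝ), 0 < ν → 0 < T →
    ∀ (u : ℝ → EuclideanSpace ℝ (Fin 3) → EuclideanSpace ℝ (Fin 3)) (p : ℝ → EuclideanSpace ℝ (Fin 3) → ℝ),
      Literature.Analysis.FluidPDE.IsMaximalSmoothSolution ν 0 u p T →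
      Literature.Analysis.FluidPDE.IsLerayHopfOn T ν 0 (u 0) u →
      Literature.Analysis.FluidPDE.HasRapidSpatialDecay (u 0) →
      (∀ (ρ₀ : ℝ), 0 < ρ₀ → ∀ t₁ ∈ Set.Ico 0 T, ∃ t ∈ Set.Ico t₁ T,
        ∃ (x : EuclideanSpace ℝ (Fin 3)) (ρ : ℝ), 0 < ρ ∧ ρ < ρ₀ ∧
          (⨆ z, ‖Literature.Analysis.FluidPDE.curl (u t) z‖) ≤ 2 * ‖Literature.Analysis.FluidPDE.curl (u t) x‖ ∧
          Metric.ball x ρ ⊆ {y | (⨆ z, ‖Literature.Analysis.FluidPDE.curl (u t) z‖) ≤ 4 * ‖Literature.Analysis.FluidPDE.curl (u t) y‖} ∧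
          (∀ (x' : EuclideanSpace ℝ (Fin 3)) (ρ' : ℝ),
            (⨆ z, ‖Literature.Analysis.FluidPDE.curl (u t) z‖) ≤ 2 * ‖Literature.Analysis.FluidPDE.curl (u t) x'‖ →
            Metric.ball x' ρ' ⊆ {y | (⨆ z, ‖Literature.Analysis.FluidPDE.curl (u t) z‖) ≤ 4 * ‖Literature.Analysis.FluidPDE.curl (u t) y‖} →
            ρ' ≤ 2 * ρ)) →
      ∃ (M t₀ R : ℝ) (g₁ : ℝ → ℝ), 1 ≤ M ∧ 0 ≤ t₀ ∧ t₀ < T ∧ 0 < R ∧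
        MeasureTheory.IntegrableOn g₁ (Set.Ico t₀ T) ∧
        ∀ t ∈ Set.Ico t₀ T, ∀ (x : EuclideanSpace ℝ (Fin 3)) (ρ : ℝ), 0 < ρ → M * ρ ≤ R →
          (⨆ z, ‖Literature.Analysis.FluidPDE.curl (u t) z‖) ≤ 2 * ‖Literature.Analysis.FluidPDE.curl (u t) x‖ →
          Metric.ball x ρ ⊆ {y | (⨆ z, ‖Literature.Analysis.FluidPDE.curl (u t) z‖) ≤ 4 * ‖Literature.Analysis.FluidPDE.curl (u t) y‖} →
          (∀ (x' : EuclideanSpace ℝ (Fin 3)) (ρ' : ℝ),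
            (⨆ z, ‖Literature.Analysis.FluidPDE.curl (u t) z‖) ≤ 2 * ‖Literature.Analysis.FluidPDE.curl (u t) x'‖ →
            Metric.ball x' ρ' ⊆ {y | (⨆ z, ‖Literature.Analysis.FluidPDE.curl (u t) z‖) ≤ 4 * ‖Literature.Analysis.FluidPDE.curl (u t) y‖} →
            ρ' ≤ 2 * ρ) →
          ∀ e : EuclideanSpace ℝ (Fin 3), ‖e‖ = 1 →
            |inner ℝ ((fderiv ℝ (fun z : EuclideanSpace ℝ (Fin 3) => ∫ y, (4 * Real.pi * ‖z - y‖ ^ 3)⁻¹ • Literature.Analysis.FluidPDE.cross ((Metric.ball x R).indicator (Literature.Analysis.FluidPDE.curl (u t)) y) (z - y)) x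
              - fderiv ℝ (fun z : EuclideanSpace ℝ (Fin 3) => ∫ y, (4 * Real.pi * ‖z - y‖ ^ 3)⁻¹ • Literature.Analysis.FluidPDE.cross ((Metric.ball x (M * ρ)).indicator (Literature.Analysis.FluidPDE.curl (u t)) y) (z - y)) x) e) e|
              ≤ g₁ t) :=
  ⟨fun h ν T hν hT u p hmax hlh hdec _ => h ν T hν hT u p hmax hlh hdec, shellLocality_of_collapseCase⟩

/-- **B ⇔ shell locality in the collapsing-core regime.** The crux `CoreLogGas.BlowupIsLocallyDriven` is equivalent to
the one open registered stub `stub_shellLocalityCollapse` of line `registered` (statement verbatim): the line's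
far-field / enstrophy / regime cut isolates the difficulty of the crux without lowering it. [folklore] -/
theorem blowupIsLocallyDriven_iff_shellLocalityCollapse :
    Summit.NavierStokesRegularity.NavierStokesRegularity.Theses.CoreLogGas.BlowupIsLocallyDriven ↔
    (∀ (ν T : ℝ), 0 < ν → 0 < T →
    ∀ (u : ℝ → EuclideanSpace ℝ (Fin 3) → EuclideanSpace ℝ (Fin 3)) (p : ℝ → EuclideanSpace ℝ (Fin 3) → ℝ),
      Literature.Analysis.FluidPDE.IsMaximalSmoothSolution ν 0 u p T →
      Literature.Analysis.FluidPDE.IsLerayHopfOn T ν 0 (u 0) u →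
      Literature.Analysis.FluidPDE.HasRapidSpatialDecay (u 0) →
      (∀ (ρ₀ : ℝ), 0 < ρ₀ → ∀ t₁ ∈ Set.Ico 0 T, ∃ t ∈ Set.Ico t₁ T,
        ∃ (x : EuclideanSpace ℝ (Fin 3)) (ρ : ℝ), 0 < ρ ∧ ρ < ρ₀ ∧
          (⨆ z, ‖Literature.Analysis.FluidPDE.curl (u t) z‖) ≤ 2 * ‖Literature.Analysis.FluidPDE.curl (u t) x‖ ∧
          Metric.ball x ρ ⊆ {y | (⨆ z, ‖Literature.Analysis.FluidPDE.curl (u t) z‖) ≤ 4 * ‖Literature.Analysis.FluidPDE.curl (u t) y‖} ∧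
          (∀ (x' : EuclideanSpace ℝ (Fin 3)) (ρ' : ℝ),
            (⨆ z, ‖Literature.Analysis.FluidPDE.curl (u t) z‖) ≤ 2 * ‖Literature.Analysis.FluidPDE.curl (u t) x'‖ →
            Metric.ball x' ρ' ⊆ {y | (⨆ z, ‖Literature.Analysis.FluidPDE.curl (u t) z‖) ≤ 4 * ‖Literature.Analysis.FluidPDE.curl (u t) y‖} →
            ρ' ≤ 2 * ρ)) →
      ∃ (M t₀ R : ℝ) (g₁ : ℝ → ℝ), 1 ≤ M ∧ 0 ≤ t₀ ∧ t₀ < T ∧ 0 < R ∧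
        MeasureTheory.IntegrableOn g₁ (Set.Ico t₀ T) ∧
        ∀ t ∈ Set.Ico t₀ T, ∀ (x : EuclideanSpace ℝ (Fin 3)) (ρ : ℝ), 0 < ρ → M * ρ ≤ R →
          (⨆ z, ‖Literature.Analysis.FluidPDE.curl (u t) z‖) ≤ 2 * ‖Literature.Analysis.FluidPDE.curl (u t) x‖ →
          Metric.ball x ρ ⊆ {y | (⨆ z, ‖Literature.Analysis.FluidPDE.curl (u t) z‖) ≤ 4 * ‖Literature.Analysis.FluidPDE.curl (u t) y‖} →
          (∀ (x' : EuclideanSpace ℝ (Fin 3)) (ρ' : ℝ),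
            (⨆ z, ‖Literature.Analysis.FluidPDE.curl (u t) z‖) ≤ 2 * ‖Literature.Analysis.FluidPDE.curl (u t) x'‖ →
            Metric.ball x' ρ' ⊆ {y | (⨆ z, ‖Literature.Analysis.FluidPDE.curl (u t) z‖) ≤ 4 * ‖Literature.Analysis.FluidPDE.curl (u t) y‖} →
            ρ' ≤ 2 * ρ) →
          ∀ e : EuclideanSpace ℝ (Fin 3), ‖e‖ = 1 →
            |inner ℝ ((fderiv ℝ (fun z : EuclideanSpace ℝ (Fin 3) => ∫ y, (4 * Real.pi * ‖z - y‖ ^ 3)⁻¹ • Literature.Analysis.FluidPDE.cross ((Metric.ball x R).indicator (Literature.Analysis.FluidPDE.curl (u t)) y) (z - y)) x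
              - fderiv ℝ (fun z : EuclideanSpace ℝ (Fin 3) => ∫ y, (4 * Real.pi * ‖z - y‖ ^ 3)⁻¹ • Literature.Analysis.FluidPDE.cross ((Metric.ball x (M * ρ)).indicator (Literature.Analysis.FluidPDE.curl (u t)) y) (z - y)) x) e) e|
              ≤ g₁ t) :=
  blowupIsLocallyDriven_iff_shellLocality.trans shellLocality_iff_shellLocalityCollapse

end Summit.NavierStokesRegularity.NavierStokesRegularity.Theorems.BlowupIsLocallyDriven.Registered

end
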